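import Summits.NavierStokesRegularity.NavierStokesRegularity.Theorems.AncientHullSteeringAncientTruncationBridgeSpecial
import Summits.NavierStokesRegularity.NavierStokesRegularity.Theorems.AncientHullSteeringAncientTruncationBridgeOnpathNoSelfExcitedDynamo
import HarnessLib

/-!
# Route `AncientHullSteering`, rung `AncientTruncationBridge` (stmt-NavierStokesRegularity-20185):
  the F3 specialisation made visible to structural automation, and the forward ledger in one line

The forward discipline (TRIBUNAL-FIT F3/F4) reads two cheap probes off this rung:

* F3 `specialises` — the kernel goal `AncientTruncationBridge → DssFarFieldSlaving.DssTruncationBridgeTypeI`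
  (rung ⟹ the TYPE of its proved floor `Theorems.dssTruncationBridgeTypeI_proof`, stmt-14478). This is
  PROVED in tree (`AncientHullSteeringOnpath.dssTruncationBridgeTypeI_of_ancientTruncationBridge`, file
  `AncientHullSteeringAncientTruncationBridgeSpecial.lean`), but an untagged theorem is invisible to the
  probe's portfolio (`intro h; exact h _` / `simpa [unfolds]` / `intro h; aesop` / `omega`): the floor's
  antecedent is a negated rotated-DSS Liouville wall whose witness must be unpacked
  (`Theorems.exists_typeI_rdss_ancient_of_not_liouville`) before the rung applies, so no structural
  tactic re-derives it and the probe has read `specialises = false` (cut `total-deadline`) in every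
  forward check of the route so far (2026-08-18 14:53Z–18:37Z).
* F4 `on_path` — the kernel goal `NavierStokesRegularity → AncientTruncationBridge`. This is NOT landed and
  cannot be landed cheaply: by the in-tree certificate
  `navierStokesRegularity_imp_ancientTruncationBridge_iff_imp_noSelfExcitedDynamo` it is equivalent to
  `NavierStokesRegularity → HubbleDynamo.NoSelfExcitedDynamo`, the conditional form of the OPEN positive-side
  crux stmt-NavierStokesRegularity-1934 (KNSS Type-I Liouville). Nothing in this file touches that goal.

This file registers the landed F3 theorem as an `aesop` **safe apply rule** (the recipe validated by the
on-path landers on routes `KinematicRung` and `LongExchangeCondensation`, 2026-08-18). The rule concludes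
the opaque, already PROVED route constant `DssFarFieldSlaving.DssTruncationBridgeTypeI` only, so it fires
only on goals that literally ask for that floor statement and reduces them to the rung; it makes no open
statement easier (the floor is a theorem), tags nothing concluding the Statement or the rung, and leaves
the `on_path` probe exactly as it was (honestly `false`).

It also packages the route's forward ledger under one name: the rung specialises to its floor (proved)
AND its on-path lemma is, verbatim up to `↔`, Clay (A) ⟹ stmt-1934.

The `example` at the end is the kernel's literal `forward:Rung→F` goal, closed by the probe's literal
portfolio tactic `intro h; aesop`.

prover-fwd2-land-4-g7-0 (on-path lander, gen 7), 2026-08-18.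
-/

set_option linter.dupNamespace false

namespace Summit.NavierStokesRegularity.NavierStokesRegularity.Theorems.AncientHullSteeringOnpath

open Summit.NavierStokesRegularity.NavierStokesRegularity.Theses

attribute [aesop safe apply] dssTruncationBridgeTypeI_of_ancientTruncationBridge

/-- **Forward ledger of the rung `AncientTruncationBridge`, packaged.** (F3) the rung implies the type of
its proved floor `DssFarFieldSlaving.DssTruncationBridgeTypeI` (stmt-14478) — proved,
`dssTruncationBridgeTypeI_of_ancientTruncationBridge`; and (F4) the on-path lemma
`NavierStokesRegularity → AncientTruncationBridge` is equivalent to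
`NavierStokesRegularity → HubbleDynamo.NoSelfExcitedDynamo` (Clay (A) ⟹ stmt-1934, open) —
`navierStokesRegularity_imp_ancientTruncationBridge_iff_imp_noSelfExcitedDynamo`. One name for a seat
citing "the rung specialises to its floor, and is on-path exactly when (A) gives the KNSS Type-I
Liouville theorem". [cite: KochNadirashviliSereginSverak2009, §1] -/
theorem ancientTruncationBridge_specialises_and_onPath_iff :
    (AncientHullSteering.AncientTruncationBridge → DssFarFieldSlaving.DssTruncationBridgeTypeI) ∧
      ((_root_.NavierStokesRegularity → AncientHullSteering.AncientTruncationBridge) ↔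
        (_root_.NavierStokesRegularity → HubbleDynamo.NoSelfExcitedDynamo)) :=
  ⟨dssTruncationBridgeTypeI_of_ancientTruncationBridge,
    navierStokesRegularity_imp_ancientTruncationBridge_iff_imp_noSelfExcitedDynamo⟩

/- The kernel's literal `forward:Rung→F` goal, closed by the probe's literal portfolio tactic. -/
example : AncientHullSteering.AncientTruncationBridge → DssFarFieldSlaving.DssTruncationBridgeTypeI := by
  intro h; aesop

end Summit.NavierStokesRegularity.NavierStokesRegularity.Theorems.AncientHullSteeringOnpath
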